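import Literature.AlgebraicGeometry.ModuliOfAbelianVarieties.SiegelShimuraSetPrincipalDissection     -- ★ `SiegelShimuraSet.exists_eq_mk_jOfSiegel` (principal Siegel representative of a class)
import Literature.AlgebraicGeometry.ModuliOfAbelianVarieties.SiegelAdelicMarkingRationalMove          -- ★ `SiegelAdelicMarking.rationalMove`, `rationalMove_r`
import Literature.AlgebraicGeometry.ModuliOfAbelianVarieties.SiegelAdelicMarkingPrincipalTransport    -- ★ `SiegelAdelicMarking.exists_of_eq`
import Literature.AlgebraicGeometry.ModuliOfAbelianVarieties.SiegelAdelicMarkingHomKernel            -- ★ `mulVec_mem_latticeOfGL_of_forall_map_r_eq` (a reading preserves the lattice)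
import Literature.AlgebraicGeometry.ModuliOfAbelianVarieties.SiegelAdmissibleClassUnique              -- ★ `latticeOfGL_coe_eq_one_of_mem_principalLevelSubgroup_one` (`Λ_r = ℤ^{2g}` for `r ∈ K_δ(1)`)
import Literature.AlgebraicGeometry.ModuliOfAbelianVarieties.SymplecticSimilitudeCoprimeInverse      -- ★ `exists_intMatrix_map_eq_of_forall_exists_int_eq`
import HarnessLib

/-!
# Moving a marking to a PRINCIPAL SIEGEL representative of its class, and integrality of readings through principally indexed markings

Topic `AlgebraicGeometry/ModuliOfAbelianVarieties`; namespace `Literature.AlgebraicGeometry.ModuliOfAbelianVarieties`.  THEOREMS ONLY (no definition, no named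
fact, no instance, no notation, no `sorry`).  Cell `hodgecm-mathlib` (D-0151), FLOOR 0, P6 «MOD programme» (crux hLiu418 = stmt-HodgeConjecture-24832, `--supports`,
count-neutral), line «L4», DEAL #42 «the marked Serre-tensor fibre at a Siegel point» (LA4-plan (g2) 2026-09-02 09:11:38Z): the two GENERIC marking steps of that organ.

THE MATHEMATICS ([Milne2005ShimuraVarieties] §5 Lemma 5.13 p. 57, §6 Thm. 6.11 pp. 74–75; [Deligne1971TravauxShimura] 4.11–4.12).  (§1) A class `[J, rK_δ(N)]` of the
Siegel double quotient `GSp_δ(ℚ) \ (X × GSp_δ(𝔸_f) ∕ K_δ(N))` has a principal representative `[J(Z₂), rep c₂]` (`Z₂ ∈ 𝔥_g`, `rep c₂ = diag(1, u_c·1) ∈ K_δ(1)`, ★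
`SiegelShimuraSet.exists_eq_mk_jOfSiegel`); the rational mover `q ∈ GSp_δ(ℚ)` between the two representatives (★ `SiegelShimuraSet.mk_eq_mk_iff`) transports ANY
marking `mB` of a complex abelian variety `B` by `[J, r]` to a marking of the same `B` by `[J(Z₂), q_𝔸⁻¹ r]` with `q_𝔸⁻¹ r ∈ K_δ(1)` and torsion parametrisation
`w ↦ mB.r (q w)` (★ `SiegelAdelicMarking.rationalMove`, ★ `exists_of_eq`) — «the triple of `[x, a]` depends only on its `G(ℚ)`-class» read on markings.  (§0) If an
endomorphism `f` of `A` reads a RATIONAL matrix `M` on the torsion parametrisation of a marking at an INTEGRAL index `r ∈ K_δ(1) = GSp_δ(ℤ̂)`, then `M ∈ M_{2g}(ℤ)`: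
`f` preserves `Λ_r` (★ `mulVec_mem_latticeOfGL_of_forall_map_r_eq`) and `Λ_r = ℤ^{2g}` (★ `latticeOfGL_coe_eq_one_of_mem_principalLevelSubgroup_one`).

* §0 `SiegelAdelicMarking.exists_intMatrix_of_reading_of_mem_one`;
* §1 **`SiegelAdelicMarking.exists_principal_rationalMove`**.
HC_CM is proved only modulo the cell's 2 remaining named inputs (hLiu418 24832, h413 24833) until rung 0 closes; nothing here is about HC.

## References
* [Milne2005ShimuraVarieties] J. S. Milne, *Introduction to Shimura varieties* (2005), §4 pp. 48–49, §5 Lemma 5.13 p. 57, §6 Thm. 6.11 pp. 74–75.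
* [Deligne1971TravauxShimura] P. Deligne, *Travaux de Shimura*, Sém. Bourbaki 389 (1971), 4.11–4.12 pp. 148–149.
-/

set_option autoImplicit false

noncomputable section

namespace Literature.AlgebraicGeometry.ModuliOfAbelianVarieties

open Matrix
open Literature.AlgebraicGeometry.Motives (AlgPoints)
open Literature.NumberTheory.Automorphic
open Literature.NumberTheory.Adeles (latticeOfGL)

/-! ### §0 A reading through a PRINCIPALLY indexed marking is integral -/

/-- **A rational reading through a marking at `r ∈ K_δ(1)` is an integer matrix.**  If an endomorphism `f` of `A` reads `M ∈ M_{2g}(ℚ)` on the rational torsion of a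
marking `m` by `[J, r]` with `r ∈ K_δ(1) = GSp_δ(ℤ̂)`, then `M ∈ M_{2g}(ℤ)`: `f` preserves `Λ_r` (★ `mulVec_mem_latticeOfGL_of_forall_map_r_eq`) and `Λ_r = Λ_1 = ℤ^{2g}`
(★ `latticeOfGL_mul_eq_of_mem`-shape via ★ `IsLatticeBasis.mul_of_mem_principalLevelSubgroup_one`), so the columns `M eⱼ` are integral (★ `mem_latticeOfGL_one_iff`).
[cite: Milne2005ShimuraVarieties, §4 pp. 48–49 and §6 Thm. 6.11 p. 74] -/
theorem SiegelAdelicMarking.exists_intMatrix_of_reading_of_mem_one {g : ℕ} {δ : Fin g → ℕ} {J : C0pm δ} {r : ↥(gspFinAdelic δ)} {A : Literature.AlgebraicGeometry.Motives.AbelianVariety ℂ}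
    (m : SiegelAdelicMarking J r A) (hr : r ∈ principalLevelSubgroup δ 1) (f : A ⟶ A) (M : Matrix (Fin g ⊕ Fin g) (Fin g ⊕ Fin g) ℚ)
    (h : ∀ w : Fin g ⊕ Fin g → ℚ, AlgPoints.map f.hom.hom.hom (m.r w) = m.r (M *ᵥ w)) :
    ∃ Mz : Matrix (Fin g ⊕ Fin g) (Fin g ⊕ Fin g) ℤ, Mz.map (Int.cast : ℤ → ℚ) = M := by
  classical
  have hL := latticeOfGL_coe_eq_one_of_mem_principalLevelSubgroup_one (δ := δ) hr
  have hcol : ∀ i j, ∃ z : ℤ, (z : ℚ) = M i j := by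
    intro i j
    have hj : (Pi.single j (1 : ℚ) : Fin g ⊕ Fin g → ℚ) ∈ latticeOfGL ((r : ↥(gspFinAdelic δ)) : GL (Fin g ⊕ Fin g) finAdeleQ) := by
      rw [hL, Literature.NumberTheory.Adeles.mem_latticeOfGL_one_iff]
      intro i'
      by_cases hi : i' = j
      · exact ⟨1, by rw [hi, Pi.single_eq_same, Int.cast_one]⟩
      · exact ⟨0, by rw [Pi.single_eq_of_ne hi, Int.cast_zero]⟩
    have hM := m.mulVec_mem_latticeOfGL_of_forall_map_r_eq m M f h hj
    rw [hL, Literature.NumberTheory.Adeles.mem_latticeOfGL_one_iff] at hM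
    obtain ⟨zz, hz⟩ := hM i
    refine ⟨zz, ?_⟩
    rw [hz, Matrix.mulVec_single, MulOpposite.op_one, one_smul, Matrix.col_apply]
  obtain ⟨B, hB⟩ := exists_intMatrix_map_eq_of_forall_exists_int_eq hcol
  exact ⟨B, by rw [← hB]; rfl⟩

/-! ### §1 Moving a marking to a PRINCIPAL SIEGEL representative of its class -/

/-- **Every marked class has a principal Siegel representative carrying a moved marking.**  For a marking `mB` of `B` by `[J, r]` (level `K_δ(N)`, `N ≠ 0`) and a
principal-representative family `(u, rep)` (★ `exists_principalRep` shape: `|u_c|_v = 1`, `u_c ≡ c (N)`, `rep c ∈ K_δ(1)` a similitude of multiplier `u_c`): there are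
`Z₂ ∈ 𝔥_g` and `q ∈ GSp_δ(ℚ)` with `q_ℝ⁻¹ J q_ℝ = J(Z₂)`, `q_𝔸⁻¹ · r ∈ K_δ(1)`, and a marking `m₂` of the SAME `B` by `[J(Z₂), q_𝔸⁻¹ r]` with `m₂.r w = mB.r (q · w)` — ★
`SiegelShimuraSet.exists_eq_mk_jOfSiegel` (the class `[J, r]` is `[J(Z₂), rep c₂]`), ★ `SiegelShimuraSet.mk_eq_mk_iff` (its rational mover `q`, `(q̂ rep c₂)⁻¹ r ∈ K_δ(N)`),
★ `SiegelAdelicMarking.rationalMove q⁻¹` re-indexed along `q⁻¹ • J = J(Z₂)` (★ `exists_of_eq`). [cite: Milne2005ShimuraVarieties, §5 Lemma 5.13 p. 57, §6 Thm. 6.11 pp. 74–75]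
[cite: Deligne1971TravauxShimura, 4.11–4.12 pp. 148–149] -/
theorem SiegelAdelicMarking.exists_principal_rationalMove {g N : ℕ} {δ : Fin g → ℕ} (hδ : IsPolarizationType δ) (hN : N ≠ 0)
    {u : (ZMod N)ˣ → finAdeleQˣ} {rep : (ZMod N)ˣ → ↥(gspFinAdelic δ)} (hu : ∀ c v, Valued.v ((u c : finAdeleQ) v) = 1)
    (hua : ∀ c, (u c : finAdeleQ) - ((c : ZMod N).val : ℕ) ∈ levelIdeal N) (hrep1 : ∀ c, rep c ∈ principalLevelSubgroup δ 1)
    (hrep : ∀ c, IsMultiplier (typeFormOver δ finAdeleQ) (rep c : GL (Fin g ⊕ Fin g) finAdeleQ) (u c))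
    {J : C0pm δ} {r : ↥(gspFinAdelic δ)} {B : Literature.AlgebraicGeometry.Motives.AbelianVariety ℂ} (mB : SiegelAdelicMarking J r B) :
    ∃ (Z₂ : Matrix (Fin g) (Fin g) ℂ) (hZ₂ : Z₂ ∈ siegelUpperHalfSpace g) (q : ↥(gspRational δ))
      (m₂ : SiegelAdelicMarking ⟨SiegelModuli.jOfSiegel δ Z₂, SiegelComplexRecordSystem.jOfSiegel_mem_C0pm hδ.1 hZ₂⟩
        ((gspRationalToFinAdelic δ q⁻¹ : ↥(gspFinAdelic δ)) * r) B),
      (gspRationalToFinAdelic δ q⁻¹ : ↥(gspFinAdelic δ)) * r ∈ principalLevelSubgroup δ 1 ∧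
      conjJ (((gspRationalToReal δ q)⁻¹ : ↥(gspReal δ)) : GL (Fin g ⊕ Fin g) ℝ) (J : Matrix (Fin g ⊕ Fin g) (Fin g ⊕ Fin g) ℝ) =
        SiegelModuli.jOfSiegel δ Z₂ ∧
      ∀ w : Fin g ⊕ Fin g → ℚ, m₂.r w = mB.r ((((q : ↥(gspRational δ)) : GL (Fin g ⊕ Fin g) ℚ) : Matrix (Fin g ⊕ Fin g) (Fin g ⊕ Fin g) ℚ) *ᵥ w) := by
  -- a principal Siegel representative `[J(Z₂), rep c₂]` of the class `[J, r]`
  have hpr := SiegelShimuraSet.exists_eq_mk_jOfSiegel hδ hN hu hua hrep (SiegelShimuraSet.mk δ (principalLevelSubgroup δ N) J r)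
  obtain ⟨c₂, Z₂, hcls₂⟩ := hpr
  -- its rational mover `q`: `q • J(Z₂) = J`, `(q̂ · rep c₂)⁻¹ · r ∈ K_δ(N)`
  have hmk := (SiegelShimuraSet.mk_eq_mk_iff δ (principalLevelSubgroup δ N) _ _ _ _).1 hcls₂
  obtain ⟨q, hqJ, hqr⟩ := hmk
  rw [MulAction.Quotient.smul_mk, smul_eq_mul, QuotientGroup.eq] at hqr
  -- `q̂⁻¹ r = rep c₂ · ((q̂ rep c₂)⁻¹ r) ∈ K_δ(1)`
  have hr₂1 : (gspRationalToFinAdelic δ q⁻¹ : ↥(gspFinAdelic δ)) * r ∈ principalLevelSubgroup δ 1 := by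
    have e : (gspRationalToFinAdelic δ q⁻¹ : ↥(gspFinAdelic δ)) * r = rep c₂ * ((gspRationalToFinAdelic δ q * rep c₂)⁻¹ * r) := by
      rw [map_inv]; group
    rw [e]
    exact mul_mem (hrep1 c₂) (principalLevelSubgroup_anti δ (one_dvd N) hqr)
  -- `q⁻¹ • J = J(Z₂)`
  have hJ : conjAct δ (gspRationalToReal δ q⁻¹) J =
      ⟨SiegelModuli.jOfSiegel δ (Z₂ : Matrix (Fin g) (Fin g) ℂ), SiegelComplexRecordSystem.jOfSiegel_mem_C0pm hδ.1 Z₂.2⟩ := by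
    have h1 : conjAct δ (gspRationalToReal δ q⁻¹) (conjAct δ (gspRationalToReal δ q)
        ⟨SiegelModuli.jOfSiegel δ (Z₂ : Matrix (Fin g) (Fin g) ℂ), jOfSiegel_coe_mem_C0pm hδ.1 Z₂⟩) =
        ⟨SiegelModuli.jOfSiegel δ (Z₂ : Matrix (Fin g) (Fin g) ℂ), jOfSiegel_coe_mem_C0pm hδ.1 Z₂⟩ := by
      rw [← conjAct_mul, ← map_mul, inv_mul_cancel, map_one, conjAct_one]
    rw [hqJ] at h1
    exact h1
  -- the moved marking
  have hmv := SiegelAdelicMarking.exists_of_eq hJ (mB.rationalMove q⁻¹)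
  obtain ⟨m₂, -, -, -, hm₂r⟩ := hmv
  refine ⟨(Z₂ : Matrix (Fin g) (Fin g) ℂ), Z₂.2, q, m₂, hr₂1, ?_, fun w => ?_⟩
  · have e := congrArg Subtype.val hJ
    rw [coe_conjAct, map_inv] at e
    exact e
  · rw [hm₂r w, SiegelAdelicMarking.rationalMove_r, Subgroup.coe_inv, inv_inv]

end Literature.AlgebraicGeometry.ModuliOfAbelianVarieties

end
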